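import Literature.MathematicalPhysics.QuantumLattice.WilsonSingleLinkContraction
import Literature.MathematicalPhysics.QuantumLattice.WilsonLoopsProofs
import HarnessLib

/-!
# The perimeter-law UPPER bound for Wilson loops in every Gibbs measure (Chatterjee, CMP 385 (2021), Lemma 12.3)

S. Chatterjee, *A probabilistic mechanism for quark confinement*, CMP **385** (2021) [Chatterjee2021], **Lemma 12.3**:
«For any rectangular loop `ℓ` with side-lengths `R` and `T`, `|⟨W_ℓ⟩| ≤ C₁ e^{−C₂(R+T)}` for any Gibbs measure of our
lattice gauge theory on `ℤ^d`» («the perimeter law upper bound holds in complete generality»; the conditional version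
is Simon–Yaffe 1982). Printed proof: condition on the complement of the `T` links of one side; given the rest these
links are independent (no two share a plaquette), `⟨W_ℓ⟩' = tr(⟨π(ω_{e₁})⟩' ⋯ ⟨π(ω_{e_T})⟩' π(ω_{e_{T+1}}) ⋯ π(ω_{e_k}))`,
and each `⟨π(ω_e)⟩'` has operator norm `≤ 1 − ε` (Lemma 12.2).

Proved here for EVERY compact metrisable gauge group `G`, continuous `ρ`, `β`, and continuous unitary `π` with some
`π(g₀) = c·1`, `c ≠ 1` (Schur for an irreducible `π` non-trivial on the centre): for every DLR state
`μ ∈ ymGibbsMeasures ρ β`, base point, plane, `R ≥ 1` and `T`, `‖∫ tr π(hol_{R×T}) dμ‖ ≤ m (1 − e^{−2B₀})^T`,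
`B₀ = |β| (N + C) 2(d−1)` (`norm_integral_trace_rect_le_perimeter`, plane `(i, 0)`, the `T` side along `0`;
`norm_integral_trace_rect_le_perimeter_of_ne`, any plane). Ingredients: the DLR equation for the column `Λ` of the `T`
links of the far vertical side; `tr π(A B C⁻¹ D⁻¹) = tr(π(B) M)` with `M` frozen under `γ_Λ`; the tree's bootstrap
`matrixIntegral_prod_eq_prod` (Lemma 3.2, kernel form) with the single links of the column as blocks; the single-link
contraction `l2_opNorm_matrixIntegral_rep_le` (Lemma 12.2); `|tr X| ≤ m ‖X‖_op`, `‖XY‖_op ≤ ‖X‖_op ‖Y‖_op`, `‖π(g)‖_op ≤ 1`.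

## References
* S. Chatterjee, CMP 385 (2021), arXiv:2006.16229: §12, Lemmas 12.2, 12.3; eq. (12.2)–(12.4).
* B. Simon, L. G. Yaffe, *Rigorous perimeter law upper bound on Wilson loops*, Phys. Lett. B 115 (1982) 145–147.
-/

noncomputable section

open MeasureTheory ProbabilityTheory Filter Function Finset Matrix
open scoped Topology Matrix.Norms.L2Operator

namespace Literature.MathematicalPhysics.QuantumLattice

open Literature.Probability.LatticeModels

/-! ### §1 Matrix analysis in the `L²` operator norm -/

section MatrixAnalysis

variable {m : ℕ}

/-- An entry is bounded by the `L²` operator norm. [folklore] -/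
private theorem norm_entry_le_l2_opNorm (A : Matrix (Fin m) (Fin m) ℂ) (i j : Fin m) : ‖A i j‖ ≤ ‖A‖ := by
  classical
  set x : EuclideanSpace ℂ (Fin m) := EuclideanSpace.single j (1 : ℂ) with hx
  have hxn : ‖x‖ = 1 := by rw [hx]; simp
  have h1 := Matrix.l2_opNorm_mulVec A x
  rw [hxn, mul_one] at h1
  have h2 : ‖((EuclideanSpace.equiv (Fin m) ℂ).symm (A.mulVec x.ofLp)) i‖ ≤
      ‖(EuclideanSpace.equiv (Fin m) ℂ).symm (A.mulVec x.ofLp)‖ := PiLp.norm_apply_le _ i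
  have h3 : ((EuclideanSpace.equiv (Fin m) ℂ).symm (A.mulVec x.ofLp)) i = A i j := by simp [hx]
  rw [h3] at h2
  exact h2.trans h1

/-- `|tr A| ≤ m ‖A‖_op` (Chatterjee 2021, (12.3)–(12.4) in a cruder form). [cite: Chatterjee2021, §12 eq. (12.4)] -/
theorem norm_trace_le_card_mul_l2_opNorm (A : Matrix (Fin m) (Fin m) ℂ) : ‖A.trace‖ ≤ m * ‖A‖ := by
  rw [Matrix.trace]
  calc ‖∑ i, A.diag i‖ ≤ ∑ i, ‖A.diag i‖ := norm_sum_le _ _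
    _ ≤ ∑ _i : Fin m, ‖A‖ := Finset.sum_le_sum fun i _ => norm_entry_le_l2_opNorm A i i
    _ = m * ‖A‖ := by simp

/-- `‖A₁ ⋯ A_k‖_op ≤ θ^k` if every `‖A_i‖_op ≤ θ`, `θ ≥ 0`. [cite: Chatterjee2021, §12 eq. (12.2)] -/
theorem l2_opNorm_list_prod_le_pow (hm : 0 < m) {θ : ℝ}
    (L : List (Matrix (Fin m) (Fin m) ℂ)) (h : ∀ A ∈ L, ‖A‖ ≤ θ) : ‖L.prod‖ ≤ θ ^ L.length := by
  induction L with
  | nil =>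
    simp only [List.prod_nil, List.length_nil, pow_zero]
    haveI : Nonempty (Fin m) := ⟨⟨0, hm⟩⟩
    exact (norm_one (α := Matrix (Fin m) (Fin m) ℂ)).le
  | cons A L ih =>
    rw [List.prod_cons, List.length_cons, pow_succ']
    have hA := h A (by simp)
    have hL := ih fun B hB => h B (List.mem_cons_of_mem _ hB)
    exact (Matrix.l2_opNorm_mul A L.prod).trans
      (mul_le_mul hA hL (norm_nonneg _) ((norm_nonneg _).trans hA))

/-- A unitary matrix has `L²` operator norm `≤ 1`. [folklore] -/
private theorem l2_opNorm_le_one_of_mem_unitaryGroup {U : Matrix (Fin m) (Fin m) ℂ}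
    (hU : U ∈ Matrix.unitaryGroup (Fin m) ℂ) : ‖U‖ ≤ 1 := by
  rcases Nat.eq_zero_or_pos m with hm | hm
  · subst hm
    have : U = 0 := Subsingleton.elim _ _
    rw [this, norm_zero]; exact zero_le_one
  · haveI : Nonempty (Fin m) := ⟨⟨0, hm⟩⟩
    exact (CStarRing.norm_of_mem_unitary (hU : U ∈ unitary (Matrix (Fin m) (Fin m) ℂ))).le

end MatrixAnalysis

/-! ### §2 Geometry of the column and small kernel facts -/

section Column

variable {d N m : ℕ} [NeZero d] {G : Type*} [Group G] [TopologicalSpace G] [IsTopologicalGroup G]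
  [CompactSpace G] [MeasurableSpace G] [BorelSpace G] [SecondCountableTopology G] [T2Space G]
  (ρ : G →* Matrix (Fin N) (Fin N) ℂ) (π : G →* Matrix (Fin m) (Fin m) ℂ)

omit [NeZero d] in
/-- An edge of the plaquette `p` has the base point of `p` in its own direction. [folklore] -/
private theorem apply_dir_eq_of_mem_plaquetteEdges' {p : ZdPlaquette d} {u : ZdEdge d}
    (hu : u ∈ plaquetteEdges p) : u.1 u.2 = p.1 u.2 := by
  have hne : p.2.1.1 ≠ p.2.1.2 := (p.2.2).ne
  simp only [plaquetteEdges, Finset.mem_insert, Finset.mem_singleton] at hu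
  rcases hu with rfl | rfl | rfl | rfl <;> simp [hne, Ne.symm hne]

omit [TopologicalSpace G] [IsTopologicalGroup G] [CompactSpace G] [MeasurableSpace G] [BorelSpace G]
  [SecondCountableTopology G] [T2Space G] in
/-- **No two links of a vertical column share a plaquette** (Chatterjee 2021, proof of Lemma 12.3): a link of the
column through `y` on a plaquette through the `k`-th column link is the `k`-th link. [cite: Chatterjee2021, Lemma 12.3 (proof)] -/
theorem mem_colEdges_one_of_mem_closure {y : Site d} {T k : ℕ}
    {e : ZdEdge d} (he : e ∈ (plaquettesTouching (colEdges (y + Pi.single 0 ((k : ℕ) : ℤ)) 1)).biUnion plaquetteEdges)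
    (heΛ : e ∈ colEdges y T) : e ∈ colEdges (y + Pi.single 0 ((k : ℕ) : ℤ)) 1 := by
  classical
  obtain ⟨p, hp, hep⟩ := Finset.mem_biUnion.1 he
  obtain ⟨w, hw⟩ := mem_plaquettesTouching_iff.1 hp
  obtain ⟨hwp, hwc⟩ := Finset.mem_inter.1 hw
  obtain ⟨t, ht, rfl⟩ := mem_colEdges.1 hwc
  obtain ⟨s, hs, rfl⟩ := mem_colEdges.1 heΛ
  have ht0 : t = 0 := by omega
  subst ht0
  have h1 := apply_dir_eq_of_mem_plaquetteEdges' hep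
  have h2 := apply_dir_eq_of_mem_plaquetteEdges' hwp
  simp only [Pi.add_apply, Pi.single_eq_same, Nat.cast_zero] at h1 h2
  refine mem_colEdges.2 ⟨0, Nat.zero_lt_one, ?_⟩
  have hsk : (s : ℤ) = k := by linarith
  simp [hsk]

omit [NeZero d] [TopologicalSpace G] [IsTopologicalGroup G] [CompactSpace G] [MeasurableSpace G] [BorelSpace G]
  [SecondCountableTopology G] [T2Space G] in
/-- `lineHol` only sees the links along the walk. [folklore] -/
private theorem lineHol_congr' {U V : LGConfig d G} (i : Fin d) : ∀ (n : ℕ) (y : Site d),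
    (∀ s : ℕ, s < n → U (y + Pi.single i (s : ℤ), i) = V (y + Pi.single i (s : ℤ), i)) → lineHol U i n y = lineHol V i n y
  | 0, _, _ => rfl
  | n + 1, y, h => by
      rw [lineHol_succ, lineHol_succ]
      have h0 := h 0 (Nat.succ_pos n)
      simp only [Nat.cast_zero, Pi.single_zero, add_zero] at h0
      rw [h0, lineHol_congr' i n (y + Pi.single i 1) fun s hs => ?_]
      have := h (s + 1) (Nat.succ_lt_succ hs)
      rwa [Nat.cast_succ, add_comm (s : ℤ) 1, Pi.single_add, ← add_assoc] at this

/-- Entries of the entrywise integral. [folklore] -/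
private theorem matrixIntegral_apply'' {X : Type*} [MeasurableSpace X] (μ : Measure X)
    (F : X → Matrix (Fin m) (Fin m) ℂ) (a b : Fin m) : matrixIntegral μ F a b = ∫ x, F x a b ∂μ := rfl

/-- `∫ tr(F · M) = tr((∫F) · M)` for a constant matrix `M` and integrable entries. [folklore] -/
private theorem integral_trace_mul_const {X : Type*} [MeasurableSpace X] (μ : Measure X)
    {F : X → Matrix (Fin m) (Fin m) ℂ} (hF : ∀ a b, Integrable (fun x => F x a b) μ)
    (M : Matrix (Fin m) (Fin m) ℂ) :
    ∫ x, (F x * M).trace ∂μ = (matrixIntegral μ F * M).trace := by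
  simp only [Matrix.trace, Matrix.diag, Matrix.mul_apply]
  rw [integral_finsetSum _ fun a _ => integrable_finsetSum _ fun b _ => (hF a b).mul_const _]
  refine Finset.sum_congr rfl fun a _ => ?_
  rw [integral_finsetSum _ fun b _ => (hF a b).mul_const _]
  refine Finset.sum_congr rfl fun b _ => ?_
  rw [integral_mul_const, matrixIntegral_apply'']

omit [NeZero d] [Group G] [TopologicalSpace G] [IsTopologicalGroup G] [CompactSpace G] [BorelSpace G]
  [SecondCountableTopology G] [T2Space G] in
/-- One DLR equation for a vector-valued observable. [cite: Georgii2011, Rem. 1.24] -/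
private theorem integral_integral_eq_of_gibbs {E : Type*} [NormedAddCommGroup E] [NormedSpace ℝ E] [CompleteSpace E]
    {γ : Specification (ZdEdge d) G} (hγ : IsSpecification γ)
    {μ : Measure (LGConfig d G)} (hμ : IsGibbsMeasure γ μ) (Λ : Finset (ZdEdge d))
    {f : LGConfig d G → E} (hf : Integrable f μ) :
    ∫ η, ∫ σ, f σ ∂(γ Λ η) ∂μ = ∫ σ, f σ ∂μ := by
  haveI := hμ.1
  let κ : ProbabilityTheory.Kernel (LGConfig d G) (LGConfig d G) := ⟨γ Λ, hγ.measurable_fun Λ⟩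
  have hcomp : (κ ∘ₖ ProbabilityTheory.Kernel.const Unit μ) () = μ := by
    rw [ProbabilityTheory.Kernel.comp_apply, ProbabilityTheory.Kernel.const_apply]
    ext A hA
    change (μ.bind (γ Λ)) A = μ A
    rw [Measure.bind_apply hA (hγ.measurable_fun Λ).aemeasurable]
    exact hμ.2 Λ A hA
  have hfi : Integrable f ((κ ∘ₖ ProbabilityTheory.Kernel.const Unit μ) ()) := by rwa [hcomp]
  have key := ProbabilityTheory.Kernel.integral_comp hfi
  rw [hcomp, ProbabilityTheory.Kernel.const_apply] at key
  exact key.symm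

/-! ### §3 Chatterjee's Lemma 12.3 -/

/-- ★ **Chatterjee 2021, Lemma 12.3 — the perimeter-law upper bound, for every Gibbs measure and every compact gauge
group** (loops in a plane containing the time direction, the `T`-side vertical; other planes by the coordinate
symmetry of the theory). For continuous `ρ` with `|Re tr ρ(U_p)| ≤ C`, a continuous unitary `π : G →* M_m(ℂ)` with a
central `g₀`, `π(g₀) = c·1`, `c ≠ 1`, every `β`, every DLR state `μ ∈ ymGibbsMeasures ρ β`, every base point `x`, every
spatial direction `i ≠ 0`, every `R ≥ 1` and every `T`:
`‖∫ tr π(hol_{rectWalk x i 0 R T}) dμ‖ ≤ m · (1 − e^{−2|β|(N+C)·2(d−1)})^T`. [cite: Chatterjee2021, Lemma 12.3] -/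
theorem norm_integral_trace_rect_le_perimeter (hρ : Continuous ρ) {C : ℝ} (hC0 : 0 ≤ C)
    (hC : ∀ (x : Site d) (i j : Fin d) (U : LGConfig d G), |plaquetteObs ρ x i j U| ≤ C) (β : ℝ)
    (hπ : Continuous π) (hπu : ∀ g, π g ∈ Matrix.unitaryGroup (Fin m) ℂ) {g₀ : G} {c : ℂ}
    (hc : π g₀ = c • (1 : Matrix (Fin m) (Fin m) ℂ)) (hc1 : c ≠ 1)
    {μ : Measure (LGConfig d G)} (hμ : μ ∈ ymGibbsMeasures ρ β) (x : Site d) {i : Fin d} (hi : i ≠ 0)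
    {R : ℕ} (hR : 1 ≤ R) (T : ℕ) :
    ‖∫ U, (π (walkHolonomy U (rectWalk x i 0 R T))).trace ∂μ‖ ≤
      m * (1 - Real.exp (-(2 * (|β| * ((N + C) * (2 * (d - 1 : ℕ) : ℕ)))))) ^ T := by
  classical
  have hγ := QuantumFieldTheory.isSpecification_ymSpecification_of_t2Space (d := d) ρ hρ β
  haveI : ∀ (Λ' : Finset (ZdEdge d)) (ζ : LGConfig d G), IsProbabilityMeasure (ymSpecification ρ β Λ' ζ) :=
    fun Λ' ζ => hγ.isProbability Λ' ζ
  haveI : IsProbabilityMeasure μ := hμ.1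
  set θ : ℝ := 1 - Real.exp (-(2 * (|β| * ((N + C) * (2 * (d - 1 : ℕ) : ℕ))))) with hθ
  have hθ0 : 0 ≤ θ := by
    rw [hθ, sub_nonneg]; exact Real.exp_le_one_iff.2 (by
      have : 0 ≤ |β| * ((N + C) * (2 * (d - 1 : ℕ) : ℕ)) := by positivity
      linarith)
  -- the column of the up-going vertical side and the loop observable
  set y : Site d := x + Pi.single i (R : ℤ) with hy
  set Λ : Finset (ZdEdge d) := colEdges y T with hΛ
  set W : LGConfig d G → ℂ := fun U => (π (walkHolonomy U (rectWalk x i 0 R T))).trace with hW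
  have hWc : Continuous W := (hπ.comp (continuous_walkHolonomy _)).matrix_trace
  have hWb : ∀ U, ‖W U‖ ≤ m := fun U => by
    simp only [hW]
    refine (norm_trace_le_card_mul_l2_opNorm _).trans ?_
    exact (mul_le_mul_of_nonneg_left (l2_opNorm_le_one_of_mem_unitaryGroup (hπu _)) (Nat.cast_nonneg m)).trans
      (by rw [mul_one])
  have hWi : ∀ ν : Measure (LGConfig d G), IsProbabilityMeasure ν → Integrable W ν := fun ν _ =>
    Integrable.of_bound hWc.aestronglyMeasurable m (ae_of_all _ hWb)
  -- the frozen matrix `M(η) = π(C⁻¹ D⁻¹ A)` and the column `π(B) = col`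
  set M : LGConfig d G → Matrix (Fin m) (Fin m) ℂ := fun U =>
    π ((lineHol U i R (x + Pi.single 0 (T : ℤ)))⁻¹ * (lineHol U 0 T x)⁻¹ * lineHol U i R x) with hM
  have hWeq : ∀ U, W U = (colMat π U y T * M U).trace := fun U => by
    simp only [hW, hM, walkHolonomy_rectWalk, ← map_lineHol_zero π U T y, ← map_mul]
    rw [show lineHol U i R x * lineHol U 0 T (x + Pi.single i (R : ℤ)) *
        (lineHol U i R (x + Pi.single 0 (T : ℤ)))⁻¹ * (lineHol U 0 T x)⁻¹ =
        lineHol U i R x * (lineHol U 0 T y * ((lineHol U i R (x + Pi.single 0 (T : ℤ)))⁻¹ *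
          (lineHol U 0 T x)⁻¹)) by rw [hy]; group, map_mul, Matrix.trace_mul_comm, ← map_mul]
    congr 2
    group
  -- `M` does not read the column `Λ`
  have hMdep : ∀ U V : LGConfig d G, (∀ e, e ∉ Λ → U e = V e) → M U = M V := by
    intro U V hUV
    have hnot : ∀ (z : Site d) (j : Fin d) (s : ℕ), (j ≠ 0 ∨ (j = 0 ∧ z = x ∧ s < T)) →
        (z + Pi.single j (s : ℤ), j) ∉ Λ := by
      intro z j s hj hmem
      obtain ⟨t, ht, he⟩ := mem_colEdges.1 hmem
      rcases hj with hj | ⟨rfl, rfl, hs⟩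
      · exact hj (congrArg Prod.snd he)
      · have h1 := congrArg (fun e : ZdEdge d => e.1 i) he
        simp only [hy, Pi.add_apply, Pi.single_eq_same, Pi.single_eq_of_ne hi, add_zero] at h1
        have : (R : ℤ) = 0 := by linarith
        omega
    have e1 : lineHol U i R (x + Pi.single (0 : Fin d) (T : ℤ)) = lineHol V i R (x + Pi.single (0 : Fin d) (T : ℤ)) :=
      lineHol_congr' i R _ fun s _ => hUV _ (hnot _ i s (Or.inl hi))
    have e2 : lineHol U 0 T x = lineHol V 0 T x :=
      lineHol_congr' (0 : Fin d) T x fun s hs => hUV _ (hnot x 0 s (Or.inr ⟨rfl, rfl, hs⟩))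
    have e3 : lineHol U i R x = lineHol V i R x := lineHol_congr' i R x fun s _ => hUV _ (hnot x i s (Or.inl hi))
    simp only [hM, e1, e2, e3]
  have hMu : ∀ U, M U ∈ Matrix.unitaryGroup (Fin m) ℂ := fun U => hπu _
  -- Step 1 (DLR): `∫ W dμ = ∫ γ_Λ(W | η) dμ(η)`
  have hDLR : ∫ U, W U ∂μ = ∫ η, ∫ U, W U ∂(ymSpecification ρ β Λ η) ∂μ :=
    (integral_integral_eq_of_gibbs hγ hμ Λ (hWi μ inferInstance)).symm
  -- Step 2: for every boundary condition, `γ_Λ(W | η) = tr(P(η) M(η))`, `P(η) = Π_t P_t(η)`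
  have hkernel : ∀ η : LGConfig d G, ‖∫ U, W U ∂(ymSpecification ρ β Λ η)‖ ≤ m * θ ^ T := by
    intro η
    -- properness: `M = M η` a.s.
    have hae : ∀ᵐ U ∂(ymSpecification ρ β Λ η), W U = (colMat π U y T * M η).trace := by
      filter_upwards [hγ.proper Λ η] with U hU
      rw [hWeq U, hMdep U η fun e he => hU e he]
    rw [integral_congr_ae hae]
    have hcolc : ∀ a b, Integrable (fun U => colMat π U y T a b) (ymSpecification ρ β Λ η) := fun a b =>
      Integrable.of_bound ((continuous_apply b).comp ((continuous_apply a).comp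
        (continuous_colMat (d := d) π hπ T y))).aestronglyMeasurable 1
        (ae_of_all _ fun U => norm_colMat_apply_le_one π hπu U y T a b)
    rw [integral_trace_mul_const _ hcolc (M η)]
    -- the bootstrap with single-link blocks
    set L : List (Finset (ZdEdge d) × (LGConfig d G → Matrix (Fin m) (Fin m) ℂ)) :=
      (List.range T).map fun k => (colEdges (y + Pi.single 0 ((k * 1 : ℕ) : ℤ)) 1,
        fun U => colMat π U (y + Pi.single 0 ((k * 1 : ℕ) : ℤ)) 1) with hL
    have hprod : ∀ U, colMat π U y T = (L.map fun bk => bk.2 U).prod := fun U => by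
      have h := colMat_mul_eq_prod π U y 1 T
      rw [mul_one] at h
      rw [h, hL, List.map_map]
      rfl
    have hmemL : ∀ bk ∈ L, ∃ k, k < T ∧ bk = (colEdges (y + Pi.single 0 ((k * 1 : ℕ) : ℤ)) 1,
        fun U => colMat π U (y + Pi.single 0 ((k * 1 : ℕ) : ℤ)) 1) := by
      intro bk hbk
      rw [hL, List.mem_map] at hbk
      obtain ⟨k, hk, rfl⟩ := hbk
      exact ⟨k, List.mem_range.1 hk, rfl⟩
    have hsubΛ : ∀ k, k < T → colEdges (y + Pi.single 0 ((k * 1 : ℕ) : ℤ)) 1 ⊆ Λ := by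
      intro k hk e he
      obtain ⟨t, ht, rfl⟩ := mem_colEdges.1 he
      have ht0 : t = 0 := by omega
      subst ht0
      refine mem_colEdges.2 ⟨k, hk, ?_⟩
      simp
    have hfac := matrixIntegral_prod_eq_prod ρ hρ β Λ L
      (fun bk hbk => by obtain ⟨k, hk, rfl⟩ := hmemL bk hbk; exact hsubΛ k hk)
      (by
        rw [hL, List.pairwise_map]
        refine List.Pairwise.imp_of_mem ?_ (List.pairwise_lt_range (n := T))
        intro k k' hk hk' hkk'
        rw [Finset.disjoint_left]
        intro e he he'
        obtain ⟨t, ht, rfl⟩ := mem_colEdges.1 he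
        obtain ⟨t', ht', h⟩ := mem_colEdges.1 he'
        have h1 := congrArg (fun e : ZdEdge d => e.1 0) h
        simp only [Pi.add_apply, Pi.single_eq_same] at h1
        push_cast at h1
        omega)
      (fun bk hbk e he heΛ => by
        obtain ⟨k, hk, rfl⟩ := hmemL bk hbk
        exact mem_colEdges_one_of_mem_closure (T := T) he heΛ)
      (fun bk hbk => by obtain ⟨k, hk, rfl⟩ := hmemL bk hbk; exact continuous_colMat (d := d) π hπ 1 _)
      (fun bk hbk U a b => by obtain ⟨k, hk, rfl⟩ := hmemL bk hbk; exact norm_colMat_apply_le_one π hπu U _ 1 a b)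
      (fun bk hbk a b => by obtain ⟨k, hk, rfl⟩ := hmemL bk hbk; exact isCylinder_colMat_apply π _ 1 a b) η
    have hPeq : matrixIntegral (ymSpecification ρ β Λ η) (fun U => colMat π U y T) =
        (L.map fun bk => matrixIntegral (ymSpecification ρ β bk.1 η) bk.2).prod := by
      rw [← hfac]
      congr 1
      funext U
      exact hprod U
    rw [hPeq]
    -- each factor is a single-link kernel expectation of `π(U_e)`, a `θ`-contraction
    have hfactor : ∀ bk ∈ L, ‖matrixIntegral (ymSpecification ρ β bk.1 η) bk.2‖ ≤ θ := by
      intro bk hbk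
      obtain ⟨k, hk, rfl⟩ := hmemL bk hbk
      set z : Site d := y + Pi.single 0 ((k * 1 : ℕ) : ℤ) with hz
      have hcol1 : colEdges z 1 = {(z, (0 : Fin d))} := by
        ext e
        rw [mem_colEdges, Finset.mem_singleton]
        constructor
        · rintro ⟨t, ht, rfl⟩
          have : t = 0 := by omega
          subst this; simp
        · rintro rfl; exact ⟨0, Nat.zero_lt_one, by simp⟩
      have hmat : (fun U : LGConfig d G => colMat π U z 1) = fun U => π (U (z, 0)) := by
        funext U
        rw [show (1 : ℕ) = 0 + 1 from rfl, colMat_succ, colMat_zero, mul_one]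
      dsimp only
      rw [hcol1, hmat]
      exact l2_opNorm_matrixIntegral_rep_le ρ π hρ hC0 hC β hπ hπu hc hc1 (z, 0) η
    rcases Nat.eq_zero_or_pos m with hm | hm
    · subst hm
      simp [Matrix.trace]
    calc ‖((L.map fun bk => matrixIntegral (ymSpecification ρ β bk.1 η) bk.2).prod * M η).trace‖
        ≤ m * ‖(L.map fun bk => matrixIntegral (ymSpecification ρ β bk.1 η) bk.2).prod * M η‖ :=
          norm_trace_le_card_mul_l2_opNorm _
      _ ≤ m * (‖(L.map fun bk => matrixIntegral (ymSpecification ρ β bk.1 η) bk.2).prod‖ * ‖M η‖) :=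
          mul_le_mul_of_nonneg_left (Matrix.l2_opNorm_mul _ _) (Nat.cast_nonneg m)
      _ ≤ m * (θ ^ T * 1) := by
          refine mul_le_mul_of_nonneg_left (mul_le_mul ?_ (l2_opNorm_le_one_of_mem_unitaryGroup (hMu η))
            (norm_nonneg _) (pow_nonneg hθ0 T)) (Nat.cast_nonneg m)
          have hlen : (L.map fun bk => matrixIntegral (ymSpecification ρ β bk.1 η) bk.2).length = T := by
            rw [List.length_map, hL, List.length_map, List.length_range]
          rw [← hlen]
          exact l2_opNorm_list_prod_le_pow hm _ fun A hA => by
            obtain ⟨bk, hbk, rfl⟩ := List.mem_map.1 hA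
            exact hfactor bk hbk
      _ = m * θ ^ T := by rw [mul_one]
  -- Step 3: integrate the uniform kernel bound
  rw [hDLR]
  have h := norm_integral_le_of_norm_le_const (μ := μ)
    (f := fun η => ∫ U, W U ∂(ymSpecification ρ β Λ η)) (C := m * θ ^ T) (ae_of_all _ hkernel)
  simpa using h

/-- **Chatterjee 2021, Lemma 12.3 in every plane** («for any rectangular loop `ℓ` with side-lengths `R` and `T` …
for any Gibbs measure»): the bound of `norm_integral_trace_rect_le_perimeter` for the rectangle `rectWalk x i j R T`
in an arbitrary coordinate plane `i ≠ j` (the `T` side along `j`), reduced to the plane `(i, 0)` by the coordinate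
permutation swapping `0` and `j`, under which the set of DLR states is invariant
(`map_relabel_edgePerm_mem_ymGibbsMeasures`, `walkHolonomy_relabel_edgePerm_rectWalk`).
[cite: Chatterjee2021, Lemma 12.3] -/
theorem norm_integral_trace_rect_le_perimeter_of_ne (hρ : Continuous ρ) {C : ℝ} (hC0 : 0 ≤ C)
    (hC : ∀ (x : Site d) (i j : Fin d) (U : LGConfig d G), |plaquetteObs ρ x i j U| ≤ C) (β : ℝ)
    (hπ : Continuous π) (hπu : ∀ g, π g ∈ Matrix.unitaryGroup (Fin m) ℂ) {g₀ : G} {c : ℂ}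
    (hc : π g₀ = c • (1 : Matrix (Fin m) (Fin m) ℂ)) (hc1 : c ≠ 1)
    {μ : Measure (LGConfig d G)} (hμ : μ ∈ ymGibbsMeasures ρ β) (x : Site d) {i j : Fin d} (hij : i ≠ j)
    {R : ℕ} (hR : 1 ≤ R) (T : ℕ) :
    ‖∫ U, (π (walkHolonomy U (rectWalk x i j R T))).trace ∂μ‖ ≤
      m * (1 - Real.exp (-(2 * (|β| * ((N + C) * (2 * (d - 1 : ℕ) : ℕ)))))) ^ T := by
  classical
  by_cases hj : j = 0
  · subst hj
    exact norm_integral_trace_rect_le_perimeter ρ π hρ hC0 hC β hπ hπu hc hc1 hμ x hij hR T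
  · -- reduce to the `j = 0` form by the coordinate permutation swapping `0` and `j`
    set σ : Equiv.Perm (Fin d) := Equiv.swap (0 : Fin d) j with hσ
    have hσj : σ j = 0 := by rw [hσ, Equiv.swap_apply_right]
    have hσi : σ i ≠ 0 := by
      intro h
      apply hij
      have : i = σ.symm 0 := (Equiv.eq_symm_apply σ).2 h
      rw [this, hσ, Equiv.symm_swap, Equiv.swap_apply_left]
    have hΨ : Measurable (relabelConfig (G := G) (edgePerm σ)) := (relabelConfig (edgePerm σ)).measurable
    have hF : Continuous fun U : LGConfig d G =>
        (π (walkHolonomy U (rectWalk (sitePerm σ x) (σ i) (σ j) R T))).trace :=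
      (hπ.comp (continuous_walkHolonomy _)).matrix_trace
    have hchange : ∫ U, (π (walkHolonomy U (rectWalk x i j R T))).trace ∂μ =
        ∫ U, (π (walkHolonomy U (rectWalk (sitePerm σ x) (σ i) (σ j) R T))).trace
          ∂(μ.map (relabelConfig (edgePerm σ))) := by
      rw [integral_map hΨ.aemeasurable hF.aestronglyMeasurable]
      simp only [walkHolonomy_relabel_edgePerm_rectWalk]
    rw [hchange, hσj]
    exact norm_integral_trace_rect_le_perimeter ρ π hρ hC0 hC β hπ hπu hc hc1
      (map_relabel_edgePerm_mem_ymGibbsMeasures ρ hρ β σ hμ) _ hσi hR T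

end Column

end Literature.MathematicalPhysics.QuantumLattice

end
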